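import Literature.Geometry.Riemannian.RicciFlowScalarCurvatureComparison
import Literature.Geometry.Lorentzian.RicciDecay
import Literature.Geometry.Lorentzian.EndVolume
import Literature.Geometry.Lorentzian.VolumeProofs
import Literature.Geometry.Lorentzian.MassCapacity
import HarnessLib

/-!
# `∫_N |R| dV < ∞` and `∫_N R φ dV` converges on a one-ended asymptotically flat manifold
# (Schoen–Yau 1979, Lemma 3.3: the mass integral `-(1/16π) ∫_N R φ √g dx`)

Schoen–Yau, Comm. Math. Phys. 65 (1979), Lemma 3.3 (pp. 71–72) gives the total mass of the
conformal metric `φ⁴ ds²` as the convergent integral `M̃ = -(1/16π) ∫_N R φ √g dx`; in the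
reductions of Cor. 3.1 in this tree (`ConformalScalarFlatSign.lean`,
`exists_conformal_negativeMass_of_massZero_of_ellipticCore`) the convergence appears as the
hypothesis `Integrable (fun x ↦ R x * φ x) (riemannianMeasure D.h)`. This file **proves** it from
the decay of the metric on the end (all results proved, no named facts):

* `PseudoRiemannianMetric.sq_scalarCurvature_le` — `S² ≤ (dim) ‖Ric‖²_g` pointwise (the
  Cauchy–Schwarz bound `(tr_g T)² ≤ (dim) |T|²_g` of `RicciFlowScalarCurvatureComparison.lean`);
* `integrable_scalarCurvature` — **`R ∈ L¹(dV_h)`** for data with one strongly asymptotically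
  flat end `h − δ = o₅(r⁻²)`: continuity on a compact core and, on the far region, the chart
  formula for the Riemannian measure (`AFEnd.setLIntegral_far`), the decay
  `|R(Φ z)| ≤ √(3K) ‖z‖⁻⁴` (from `AFEnd.exists_bound_normSq_ricci`, `‖Ric‖² ≤ K ‖z‖⁻⁸`) and the
  density bound `√(det h_{ij}) ≤ 7` — exactly as `integrable_normSq_ricci`
  (`RicciVariationStepsProofs.lean`) with the exponent `4 > 3` in place of `8`;
* `AFEnd.IsSoleEnd.exists_isCompact_cover` — a one-ended manifold is a compact set plus a far
  region; `AFEnd.exists_bound_of_tendstoAtEnd` — a continuous function with a limit at infinity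
  along the only end is bounded;
* `integrable_scalarCurvature_mul`, `integrable_scalarCurvature_mul_of_tendstoAtEnd` —
  **`R φ ∈ L¹(dV_h)`** for `φ` continuous and bounded, in particular for `φ → c` at infinity
  (Schoen–Yau's `φ → 1`).

## References

* R. Schoen, S.-T. Yau, *On the proof of the positive mass conjecture in general relativity*,
  Comm. Math. Phys. 65 (1979) 45–76, Lemma 3.3 (pp. 71–72) and (3.16).
* R. Bartnik, *The mass of an asymptotically flat manifold*, CPAM 39 (1986), §4 (integrability
  of the scalar curvature under decay conditions).
* B. O'Neill, *Semi-Riemannian geometry*, Academic Press 1983, Ch. 3, pp. 60–61, Def. 3.53.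
-/

noncomputable section

open Bundle Set Function Filter TopologicalSpace Manifold Metric MeasureTheory Measure Asymptotics
  Module Bornology
open scoped Manifold ContDiff Topology ENNReal

namespace Literature.Geometry.Lorentzian

/-! ### `S² ≤ dim · ‖Ric‖²_g` -/

namespace PseudoRiemannianMetric

section Scalar

variable {E : Type*} [NormedAddCommGroup E] [NormedSpace ℝ E] {H : Type*} [TopologicalSpace H]
  {I : ModelWithCorners ℝ E H} {M : Type*} [TopologicalSpace M] [ChartedSpace H M]
  [IsManifold I ∞ M] {n : ℕ∞ω} [Fact (1 ≤ n)] [FiniteDimensional ℝ E] [CompleteSpace E]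
  (g : PseudoRiemannianMetric I n E (TangentSpace I : M → Type _)) [g.HasLeviCivita]

omit [Fact (1 ≤ n)] [CompleteSpace E] in
/-- **`S² ≤ (dim M) ‖Ric‖²_g` pointwise** for a Riemannian metric: `S = tr_g Ric` and the
Cauchy–Schwarz bound `(tr_g T)² ≤ (dim) |T|²_g` (`trace_sq_le_finrank_mul_normSq`,
`RicciFlowScalarCurvatureComparison.lean`; Topping 2006, Cor. 2.5.5: `|Ric|² ≥ R²/n`).
O'Neill 1983, Ch. 3, Def. 3.53. [folklore] -/
theorem sq_scalarCurvature_le (hg : g.IsRiemannian) (x : M) :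
    g.scalarCurvature x ^ 2 ≤ finrank ℝ E * g.normSq x (g.ricci x) :=
  g.trace_sq_le_finrank_mul_normSq x hg (g.ricci x)

end Scalar

end PseudoRiemannianMetric

/-! ### One-ended manifolds: compact core plus far region; bounded functions -/

namespace AFEnd

variable {X : Type} [TopologicalSpace X] [ChartedSpace E3 X]

/-- **A one-ended manifold is a compact set plus a far region**: if `e` is the only end of `X`
(the complement of some far region `far R'` is compact), then for every radius `R₂` there is a
compact `K ⊆ X` with `X = K ∪ far R₂` — namely `(far R')ᶜ` together with the image of the
compact annulus `{R' ≤ ‖z‖ ≤ R₂}` under the (continuous) inverse chart of the end. Schoen–Yau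
1979, §3, p. 63 ("we may assume that `N` has only one end, so that `N ∖ N_k` is compact").
[cite: SchoenYauPMT1979, §3 p. 63] -/
theorem IsSoleEnd.exists_isCompact_cover {e : AFEnd X} (hsole : e.IsSoleEnd) (R₂ : ℝ) :
    ∃ K : Set X, IsCompact K ∧ ∀ p, p ∈ K ∨ p ∈ e.far R₂ := by
  obtain ⟨R', hRR', hcpt⟩ := hsole
  set R₃ : ℝ := max R' R₂ with hR₃
  set A : Set E3 := {z | R' ≤ ‖z‖ ∧ ‖z‖ ≤ R₃} with hA
  have hAext : A ⊆ {z | e.R < ‖z‖} := fun z hz ↦ hRR'.trans_le hz.1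
  have hAc : IsCompact A := by
    have : A = closedBall (0 : E3) R₃ ∩ {z | R' ≤ ‖z‖} := by
      ext z
      simp only [hA, mem_setOf_eq, mem_inter_iff, mem_closedBall_zero_iff]
      tauto
    rw [this]
    exact (isCompact_closedBall _ _).inter_right (isClosed_le continuous_const continuous_norm)
  have hcont : ContinuousOn e.dataChartExt {z | e.R < ‖z‖} := fun z hz ↦
    (e.contMDiffAt_dataChartExt hz).continuousAt.continuousWithinAt
  refine ⟨(e.far R')ᶜ ∪ e.dataChartExt '' A,
    hcpt.union (hAc.image_of_continuousOn (hcont.mono hAext)), fun p ↦ ?_⟩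
  by_cases hp : p ∈ e.far R₃
  · exact Or.inr (e.far_mono (le_max_right _ _) hp)
  by_cases hp' : p ∈ e.far R'
  · obtain ⟨z, hz, rfl⟩ := e.mem_far_iff.1 hp'
    refine Or.inl (Or.inr ⟨z, ⟨hz.le, ?_⟩, e.dataChartExt_of_lt z.2⟩)
    by_contra hlt
    push Not at hlt
    exact hp (e.mem_far_iff.2 ⟨z, hlt, rfl⟩)
  · exact Or.inl (Or.inl hp')

/-- **A continuous function with a limit at infinity along the only end is bounded** (the
elementary remark behind "`φ → 1`, hence `φ` is bounded" in Schoen–Yau 1979, Lemma 3.3): if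
`e` is the only end of `X`, `φ` is continuous and `φ(Φ z) → c` as `‖z‖ → ∞`
(`TendstoAtEnd e φ c`), then `|φ| ≤ C` on `X`. [folklore] -/
theorem exists_bound_of_tendstoAtEnd {e : AFEnd X} (hsole : e.IsSoleEnd) {φ : X → ℝ}
    (hφ : Continuous φ) {c : ℝ} (hlim : TendstoAtEnd e φ c) : ∃ C, ∀ x, |φ x| ≤ C := by
  -- far out, `|φ(Φ z) - c| < 1`
  have hev : ∀ᶠ z in cobounded E3, dist (endValue e φ z) c < 1 :=
    hlim.eventually (Metric.ball_mem_nhds c one_pos)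
  obtain ⟨R₀, -, hR₀⟩ := (hasBasis_cobounded_norm (E := E3)).eventually_iff.1 hev
  set R₂ : ℝ := max R₀ e.R with hR₂
  obtain ⟨K, hK, hcover⟩ := hsole.exists_isCompact_cover R₂
  obtain ⟨C₁, hC₁⟩ := hK.exists_bound_of_continuousOn hφ.continuousOn
  refine ⟨max C₁ (|c| + 1), fun x ↦ ?_⟩
  rcases hcover x with hx | hx
  · exact ((Real.norm_eq_abs _).symm.le.trans (hC₁ x hx)).trans (le_max_left _ _)
  · obtain ⟨z, hz, rfl⟩ := e.mem_far_iff.1 hx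
    have hzR₀ : R₀ ≤ ‖(z : E3)‖ := (le_max_left _ _).trans hz.le
    have h1 : dist (endValue e φ z) c < 1 := hR₀ (show (z : E3) ∈ {x | R₀ ≤ ‖x‖} from hzR₀)
    rw [endValue_of_lt e φ z.2, Real.dist_eq] at h1
    refine le_trans ?_ (le_max_right _ _)
    have := abs_sub_abs_le_abs_sub (φ (e.dataChart ⟨z, z.2⟩)) c
    have h2 : φ (e.dataChart z) = φ (e.dataChart ⟨z, z.2⟩) := rfl
    rw [h2]
    linarith

end AFEnd

/-! ### `R ∈ L¹(dV_h)` and `R φ ∈ L¹(dV_h)` -/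

/-- **`∫_N |R| dV_h < ∞`** on a one-ended asymptotically flat manifold: for data `D = (h, k)` on
a `3`-manifold `X` with an end `e` on which `h − δ = o₅(r⁻²)`
(`IsStronglyAsymptoticallyFlatWith D 0 2 0 5 0`, Schoen–Yau's (1.1)–(1.2) with `M = 0`) and
which is the only end, the scalar curvature is integrable for the Riemannian measure. `R` is
continuous (`contMDiff_scalarCurvature`), hence integrable on a compact core (the Riemannian
measure is finite on compact sets); on the far region the chart formula
`∫_{far} g dvol_h = ∫ g(Φ z) √(det h_{ij}) dz` (`AFEnd.setLIntegral_far`), the decay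
`|R(Φ z)| ≤ √(3K) ‖z‖⁻⁴` (`S² ≤ 3 ‖Ric‖²`, `sq_scalarCurvature_le`, with
`‖Ric‖² ≤ K ‖z‖⁻⁸`, `AFEnd.exists_bound_normSq_ricci`) and `√(det h_{ij}) ≤ 7`
(`AFEnd.exists_radius_sqrt_det_hCoeff_le`) reduce it to `∫_{‖z‖ > R₂} ‖z‖⁻⁴ dz < ∞`. This is
the convergence of the mass integral of Schoen–Yau 1979, Lemma 3.3 (`∫_N R φ √g dx` with
`φ → 1`); Bartnik 1986, §4. [cite: SchoenYauPMT1979, Lemma 3.3 (pp. 71–72)] -/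
theorem integrable_scalarCurvature {X : Type} [TopologicalSpace X] [ChartedSpace E3 X]
    [IsManifold (𝓡 3) ∞ X] [T2Space X] [LocallyCompactSpace X] [MeasurableSpace X] [BorelSpace X]
    (D : InitialDataSet (𝓡 3) X) [D.metric.HasLeviCivita] (e : AFEnd X)
    (haf : e.IsStronglyAsymptoticallyFlatWith D 0 2 0 5 0) (hsole : e.IsSoleEnd) :
    Integrable D.metric.scalarCurvature (riemannianMeasure D.h) := by
  set μ : Measure X := riemannianMeasure D.h with hμ
  set f : X → ℝ := D.metric.scalarCurvature with hf
  have hfc : Continuous f := D.metric.contMDiff_scalarCurvature.continuous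
  haveI : IsFiniteMeasureOnCompacts μ :=
    ⟨fun K hK ↦ riemannianVolume_lt_top_of_isCompact_holds D.h le_rfl hK⟩
  -- pointwise: `f² ≤ 3 ‖Ric‖²`
  have hsq : ∀ x, f x ^ 2 ≤ 3 * D.metric.normSq x (D.metric.ricci x) := fun x ↦ by
    have h := D.metric.sq_scalarCurvature_le D.isRiemannian_metric x
    have h3 : (finrank ℝ E3 : ℝ) = 3 := by
      rw [finrank_euclideanSpace_fin]
      norm_num
    rwa [h3] at h
  -- decay on the end and the density bound
  have hAF : e.IsMetricAsymptoticallyFlat D 2 :=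
    AFEnd.IsStronglyAsymptoticallyFlatWith.isMetricAsymptoticallyFlat_of_massZero e D haf
      (by norm_num)
  obtain ⟨K₀, R₁, hRR₁, h1R₁, hbound⟩ := e.exists_bound_normSq_ricci D two_pos hAF
  obtain ⟨R₃, hdens⟩ := e.exists_radius_sqrt_det_hCoeff_le D two_pos hAF
  set K : ℝ := max K₀ 0 with hK
  have hK0 : 0 ≤ K := le_max_right _ _
  set R₂ : ℝ := max R₁ R₃ with hR₂
  have hR₁R₂ : R₁ ≤ R₂ := le_max_left _ _
  have hR₃R₂ : R₃ ≤ R₂ := le_max_right _ _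
  have hRR₂ : e.R ≤ R₂ := hRR₁.le.trans hR₁R₂
  -- the pointwise bound `|f(Φ z)| ≤ √(3K) ‖z‖⁻⁴` for `‖z‖ ≥ R₁`
  have hptw : ∀ z : E3, R₁ ≤ ‖z‖ →
      |f (e.dataChartExt z)| ≤ Real.sqrt (3 * K) * ‖z‖ ^ (-(4 : ℝ)) := by
    intro z hz
    have hz0 : 0 < ‖z‖ := lt_of_lt_of_le (lt_of_lt_of_le one_pos h1R₁) hz
    have hb := hbound z hz
    have h8 : ‖z‖ ^ (-(2 * (2 : ℝ) + 4)) = ‖z‖ ^ (-(8 : ℝ)) := by norm_num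
    rw [h8] at hb
    have hb' : D.metric.normSq (e.dataChartExt z) (D.metric.ricci (e.dataChartExt z)) ≤
        K * ‖z‖ ^ (-(8 : ℝ)) :=
      hb.trans (mul_le_mul_of_nonneg_right (le_max_left _ _) (Real.rpow_nonneg hz0.le _))
    have h2 : f (e.dataChartExt z) ^ 2 ≤ (Real.sqrt (3 * K) * ‖z‖ ^ (-(4 : ℝ))) ^ 2 := by
      have hsq8 : (‖z‖ ^ (-(4 : ℝ))) ^ 2 = ‖z‖ ^ (-(8 : ℝ)) := by
        rw [← Real.rpow_natCast, ← Real.rpow_mul hz0.le]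
        norm_num
      rw [mul_pow, Real.sq_sqrt (by positivity), hsq8]
      calc f (e.dataChartExt z) ^ 2 ≤ 3 * D.metric.normSq _ (D.metric.ricci _) := hsq _
        _ ≤ 3 * (K * ‖z‖ ^ (-(8 : ℝ))) := by linarith
        _ = 3 * K * ‖z‖ ^ (-(8 : ℝ)) := by ring
    have hnn : 0 ≤ Real.sqrt (3 * K) * ‖z‖ ^ (-(4 : ℝ)) :=
      mul_nonneg (Real.sqrt_nonneg _) (Real.rpow_nonneg hz0.le _)
    exact abs_le_of_sq_le_sq' h2 hnn |>.elim (fun h1 h2 ↦ abs_le.2 ⟨h1, h2⟩)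
  -- the compact piece
  obtain ⟨Kc, hKc_cpt, hcover⟩ := hsole.exists_isCompact_cover R₂
  have hint_K : IntegrableOn f Kc μ := hfc.continuousOn.integrableOn_compact hKc_cpt
  -- the far region
  have hint_far : IntegrableOn f (e.far R₂) μ := by
    refine ⟨hfc.aestronglyMeasurable.restrict, ?_⟩
    rw [hasFiniteIntegral_iff_enorm]
    have hen : ∀ p, ‖f p‖ₑ = ENNReal.ofReal |f p| := fun p ↦ Real.enorm_eq_ofReal_abs (f p)
    simp only [hen]
    rw [e.setLIntegral_far D (fun p ↦ ENNReal.ofReal |f p|) hRR₂]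
    have hg : IntegrableOn (fun z : E3 ↦ 7 * Real.sqrt (3 * K) * ‖z‖ ^ (-(4 : ℝ)))
        {z | R₂ < ‖z‖} volume :=
      (AFEnd.integrableOn_rpow_neg_exterior (by norm_num : (3 : ℝ) < 4)
        (h1R₁.trans hR₁R₂)).const_mul (7 * Real.sqrt (3 * K))
    refine lt_of_le_of_lt (setLIntegral_mono'
      (isOpen_lt continuous_const continuous_norm).measurableSet (fun z hz ↦ ?_))
      (hasFiniteIntegral_iff_enorm.1 hg.2)
    have hzR₁ : R₁ ≤ ‖z‖ := hR₁R₂.trans (le_of_lt hz)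
    have hzR₃ : R₃ ≤ ‖z‖ := hR₃R₂.trans (le_of_lt hz)
    have hz0 : 0 < ‖z‖ := lt_of_lt_of_le (lt_of_lt_of_le one_pos h1R₁) hzR₁
    have hb := hptw z hzR₁
    have hd := hdens z hzR₃
    have hnn : 0 ≤ Real.sqrt (3 * K) * ‖z‖ ^ (-(4 : ℝ)) :=
      mul_nonneg (Real.sqrt_nonneg _) (Real.rpow_nonneg hz0.le _)
    have h7 : 0 ≤ 7 * Real.sqrt (3 * K) * ‖z‖ ^ (-(4 : ℝ)) := by
      rw [mul_assoc]
      exact mul_nonneg (by norm_num) hnn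
    calc ENNReal.ofReal |f (e.dataChartExt z)| * ENNReal.ofReal (Real.sqrt (Matrix.of fun i j ↦
          AFEnd.hCoeff e D z (EuclideanSpace.single i 1) (EuclideanSpace.single j 1)).det)
        ≤ ENNReal.ofReal (Real.sqrt (3 * K) * ‖z‖ ^ (-(4 : ℝ))) * ENNReal.ofReal 7 :=
          mul_le_mul' (ENNReal.ofReal_le_ofReal hb) (ENNReal.ofReal_le_ofReal hd)
      _ = ‖7 * Real.sqrt (3 * K) * ‖z‖ ^ (-(4 : ℝ))‖ₑ := by
          rw [← ENNReal.ofReal_mul hnn, Real.enorm_eq_ofReal h7]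
          congr 1
          ring
  -- conclusion
  exact integrableOn_univ.1 ((hint_K.union hint_far).mono_set fun p _ ↦ hcover p)

/-- **`∫_N R φ dV_h` converges for bounded continuous `φ`** on a one-ended asymptotically flat
manifold (`h − δ = o₅(r⁻²)` on the only end): `R ∈ L¹` (`integrable_scalarCurvature`) times a
bounded continuous factor. This is the integrability conjunct of the elliptic core of
Schoen–Yau 1979, Lemma 3.3 / Cor. 3.1 (`exists_conformal_negativeMass_of_massZero_of_ellipticCore`,
`ConformalScalarFlatSign.lean`) for any bounded conformal factor.
[cite: SchoenYauPMT1979, Lemma 3.3 (pp. 71–72)] -/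
theorem integrable_scalarCurvature_mul {X : Type} [TopologicalSpace X] [ChartedSpace E3 X]
    [IsManifold (𝓡 3) ∞ X] [T2Space X] [LocallyCompactSpace X] [MeasurableSpace X] [BorelSpace X]
    (D : InitialDataSet (𝓡 3) X) [D.metric.HasLeviCivita] (e : AFEnd X)
    (haf : e.IsStronglyAsymptoticallyFlatWith D 0 2 0 5 0) (hsole : e.IsSoleEnd) {φ : X → ℝ}
    (hφ : Continuous φ) (hbdd : ∃ C, ∀ x, |φ x| ≤ C) :
    Integrable (fun x ↦ D.metric.scalarCurvature x * φ x) (riemannianMeasure D.h) := by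
  obtain ⟨C, hC⟩ := hbdd
  exact (integrable_scalarCurvature D e haf hsole).mul_bdd hφ.aestronglyMeasurable
    (Eventually.of_forall fun x ↦ (Real.norm_eq_abs _).le.trans (hC x))

/-- **`∫_N R φ dV_h` converges when `φ → c` at infinity** (Schoen–Yau 1979, Lemma 3.3: the
mass integral `-(1/16π) ∫_N R φ √g dx` with `φ → 1`): on a one-ended asymptotically flat
manifold a continuous `φ` with `TendstoAtEnd e φ c` is bounded
(`AFEnd.exists_bound_of_tendstoAtEnd`), so `integrable_scalarCurvature_mul` applies.
[cite: SchoenYauPMT1979, Lemma 3.3 (pp. 71–72)] -/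
theorem integrable_scalarCurvature_mul_of_tendstoAtEnd {X : Type} [TopologicalSpace X]
    [ChartedSpace E3 X] [IsManifold (𝓡 3) ∞ X] [T2Space X] [LocallyCompactSpace X]
    [MeasurableSpace X] [BorelSpace X]
    (D : InitialDataSet (𝓡 3) X) [D.metric.HasLeviCivita] (e : AFEnd X)
    (haf : e.IsStronglyAsymptoticallyFlatWith D 0 2 0 5 0) (hsole : e.IsSoleEnd) {φ : X → ℝ}
    (hφ : Continuous φ) {c : ℝ} (hlim : TendstoAtEnd e φ c) :
    Integrable (fun x ↦ D.metric.scalarCurvature x * φ x) (riemannianMeasure D.h) :=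
  integrable_scalarCurvature_mul D e haf hsole hφ (AFEnd.exists_bound_of_tendstoAtEnd hsole hφ hlim)

end Literature.Geometry.Lorentzian

end
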